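import Summits.CriticalPhenomena.PercolationContinuityZ3.Theses.PercNearOneGluing
import Summits.CriticalPhenomena.PercolationContinuityZ3.Theorems.PercNearOneGluingAdditiveGluingOneBond
import Literature.Probability.Percolation.PercolationProofs
import Literature.Probability.LatticeModels.ProdBernoulliIndependence
import HarnessLib

/-!
# Crux `PercNearOneGluing.AdditiveGluing` (stmt-CriticalPhenomena-4576): one-edge affinity of
# `prodBernoulli` probabilities and the deterministic base case

Helper file for the crux `AdditiveGluing` (siege k34, variation "C1 kernel first / induction on
pivotal edges"); lands with `--supports stmt-CriticalPhenomena-4576`; it does NOT close the crux.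
It is the measure-theoretic half of the minimiser-tie reduction
(`PercNearOneGluingAdditiveGluingTieReduction.lean`): Kozma–Nitzan, arXiv:2401.12397, §5.3 ("An
inductive approach": move the weight of one edge and use linearity/concavity in that weight).

## Content (finite weighted graph `(Fin n, w)`, `P_w = prodBernoulli w` on `Set (Sym2 (Fin n))`)

* `real_update_affine`: for every event `S` and pair `e`, `s ↦ P_{w[e↦s]}(S)` is affine on `[0,1]`
  (from the landed one-bond decomposition `stub_oneBondDecomp_k15`,
  `P_w(S) = (1 − w(e))·P_{w[e↦0]}(S) + w(e)·P_{w[e↦1]}(S)`, file `…AdditiveGluingOneBond.lean`).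
* `real_eq_ite_of_zeroOne`: if every weight is `0` or `1`, `P_w(S) = 1_S({e | w e = 1})`.
* `agBody_of_zeroOne`: the `AdditiveGluing` inequality for such deterministic weights (a statement
  about one graph: relays joined to `b` and `o` joined to a relay give `o ↔ b`).
-/

namespace Summit.CriticalPhenomena.PercolationContinuityZ3.Theorems

open MeasureTheory Set
open Literature.Probability.LatticeModels Literature.Probability.Percolation

noncomputable section

/-! ### Affinity of every probability in one weight (from the landed one-bond decomposition) -/

section Decomposition

variable {n : ℕ}

/-- **Affinity along one edge**: with `w_s := w[e ↦ s]` (`s ∈ [0,1]`, realised as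
`Function.update w e (projIcc 0 1 s)`), `s ↦ P_{w_s}(S)` is affine:
`P_{w_s}(S) = P_{w[e↦0]}(S) + s · (P_{w[e↦1]}(S) − P_{w[e↦0]}(S))`. [folklore] -/
theorem real_update_affine (w : Sym2 (Fin n) → unitInterval) (e : Sym2 (Fin n))
    (S : Set (BondConfig (Fin n))) {s : ℝ} (hs : s ∈ Set.Icc (0 : ℝ) 1) :
    (prodBernoulli (Function.update w e (Set.projIcc (0:ℝ) 1 zero_le_one s))).real S =
      (prodBernoulli (Function.update w e 0)).real S +
        s * ((prodBernoulli (Function.update w e 1)).real S - (prodBernoulli (Function.update w e 0)).real S) := by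
  rw [stub_oneBondDecomp_k15 n (Function.update w e (Set.projIcc (0:ℝ) 1 zero_le_one s)) e S]
  simp only [Function.update_idem, Function.update_self, Set.projIcc_of_mem _ hs]
  ring

end Decomposition

/-! ### Deterministic weights: `P_w` is a point mass when every weight is `0` or `1` -/

section ZeroOne

open Classical

variable {n : ℕ}

/-- With all weights in `{0,1}`, `P_w(S) = 1_S(U)` for the configuration `U = {e | w e = 1}`
(every other configuration lies in a finite union of null one-coordinate cylinders). [folklore] -/
theorem real_eq_ite_of_zeroOne (w : Sym2 (Fin n) → unitInterval) (hw : ∀ e, w e = 0 ∨ w e = 1)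
    (S : Set (BondConfig (Fin n))) :
    (prodBernoulli w).real S = if {e | w e = 1} ∈ S then 1 else 0 := by
  classical
  set U : BondConfig (Fin n) := {e | w e = 1} with hU
  set bad : Sym2 (Fin n) → Set (BondConfig (Fin n)) :=
    fun e => if w e = 1 then {ω | e ∉ ω} else {ω | e ∈ ω} with hbad
  have hbadm : ∀ e, MeasurableSet (bad e) := by
    intro e
    by_cases h : w e = 1
    · simp only [hbad, h, if_true]; exact (measurableSet_mem e).compl
    · simp only [hbad, h, if_false]; exact measurableSet_mem e
  have hbad0 : ∀ e, (prodBernoulli w).real (bad e) = 0 := by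
    intro e
    rcases hw e with h | h
    · have hne : ¬ w e = 1 := by rw [h]; exact zero_ne_one
      simp only [hbad, hne, if_false]
      rw [prodBernoulli_real_setOf_mem, h]
      rfl
    · simp only [hbad, h, if_true]
      rw [prodBernoulli_real_setOf_notMem, h]
      simp
  set B : Set (BondConfig (Fin n)) := ⋃ e ∈ (Finset.univ : Finset (Sym2 (Fin n))), bad e with hB
  have hBm : MeasurableSet B := MeasurableSet.biUnion (Finset.univ : Finset (Sym2 (Fin n))).countable_toSet
    fun e _ => hbadm e
  have hB0 : (prodBernoulli w).real B = 0 := by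
    apply le_antisymm _ measureReal_nonneg
    calc (prodBernoulli w).real B ≤ ∑ e ∈ (Finset.univ : Finset (Sym2 (Fin n))), (prodBernoulli w).real (bad e) :=
          measureReal_biUnion_finset_le _ _
      _ = 0 := by simp [hbad0]
  have hBc : ∀ ω : BondConfig (Fin n), ω ∉ B ↔ ω = U := by
    intro ω
    have key : ω ∉ B ↔ ∀ e, ω ∉ bad e := by simp [hB]
    rw [key]
    constructor
    · intro h
      ext e
      have he := h e
      by_cases h1 : w e = 1
      · have : e ∈ ω := by simpa [hbad, h1] using he
        simp [hU, h1, this]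
      · have : e ∉ ω := by simpa [hbad, h1] using he
        simp [hU, h1, this]
    · rintro rfl e
      by_cases h1 : w e = 1 <;> simp [hbad, hU, h1]
  have hBcU : Bᶜ = {U} := by
    ext ω; simp only [mem_compl_iff, mem_singleton_iff]; exact hBc ω
  have hU1 : (prodBernoulli w).real {U} = 1 := by
    rw [← hBcU, measureReal_compl hBm, hB0, sub_zero, probReal_univ]
  -- split `S` along `{U} = Bᶜ` and `B`
  have hsplit := measureReal_inter_add_sdiff₀ (μ := prodBernoulli w) (s := S) hBm.compl.nullMeasurableSet
  have hnull : (prodBernoulli w).real (S \ Bᶜ) = 0 :=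
    measureReal_mono_null (fun ω hω => by simpa using hω.2) hB0 (measure_ne_top _ _)
  rw [← hsplit, hnull, add_zero, hBcU]
  by_cases hUS : U ∈ S
  · rw [if_pos hUS, Set.inter_eq_self_of_subset_right (Set.singleton_subset_iff.2 hUS), hU1]
  · rw [if_neg hUS]
    have : S ∩ {U} = ∅ := by
      ext ω; simp only [mem_inter_iff, mem_singleton_iff, mem_empty_iff_false, iff_false, not_and]
      rintro hω rfl; exact hUS hω
    rw [this, measureReal_empty]

/-- **Deterministic base case of the reduction**: with all weights in `{0,1}` the
`AdditiveGluing` inequality holds (it is a statement about one graph: if every relay is joined to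
`b` and `o` is joined to a relay then `o` is joined to `b`). [folklore] -/
theorem agBody_of_zeroOne (w : Sym2 (Fin n) → unitInterval) (hw : ∀ e, w e = 0 ∨ w e = 1)
    (A : Finset (Fin n)) (o b : Fin n) (t : ℝ) (ht : 0 ≤ t)
    (hrel : ∀ a ∈ A, 1 - t ≤ (prodBernoulli w).real (openConn a b)) :
    (prodBernoulli w).real (⋃ a ∈ A, openConn o a) - t ≤ (prodBernoulli w).real (openConn o b) := by
  classical
  set U : BondConfig (Fin n) := {e | w e = 1} with hU
  have h0 : 0 ≤ (prodBernoulli w).real (openConn o b) := measureReal_nonneg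
  by_cases ht1 : 1 ≤ t
  · have : (prodBernoulli w).real (⋃ a ∈ A, openConn o a) ≤ 1 := measureReal_le_one
    linarith
  push Not at ht1
  -- every relay is joined to `b` in the configuration `U`
  have hab : ∀ a ∈ A, (openGraph U).Reachable a b := by
    intro a ha
    have h := hrel a ha
    rw [real_eq_ite_of_zeroOne w hw (openConn a b)] at h
    by_contra hna
    have : ¬ ({e | w e = 1} : BondConfig (Fin n)) ∈ openConn a b := hna
    rw [if_neg this] at h
    linarith
  rw [real_eq_ite_of_zeroOne w hw, real_eq_ite_of_zeroOne w hw (openConn o b)]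
  by_cases hoA : ({e | w e = 1} : BondConfig (Fin n)) ∈ ⋃ a ∈ A, (openConn o a : Set (BondConfig (Fin n)))
  · rw [if_pos hoA]
    obtain ⟨a, ha, hoa⟩ : ∃ a ∈ A, ({e | w e = 1} : BondConfig (Fin n)) ∈ openConn o a := by
      simpa only [mem_iUnion, exists_prop] using hoA
    have hob : ({e | w e = 1} : BondConfig (Fin n)) ∈ openConn o b :=
      (show (openGraph U).Reachable o a from hoa).trans (hab a ha)
    rw [if_pos hob]
    linarith
  · rw [if_neg hoA]
    split_ifs <;> linarith

/-- **Registered helper stub `stub_agZeroOne_k34`** (crux stmt-CriticalPhenomena-4576): the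
`AdditiveGluing` inequality for deterministic weights (all in `{0,1}`) — the base case of the
minimiser-tie reduction. [folklore] -/
theorem stub_agZeroOne_k34 :
    ∀ (n : ℕ) (w : Sym2 (Fin n) → unitInterval), (∀ e, w e = 0 ∨ w e = 1) → ∀ (A : Finset (Fin n)) (o b : Fin n) (t : ℝ), 0 ≤ t → (∀ a ∈ A, 1 - t ≤ (prodBernoulli w).real (openConn a b)) → (prodBernoulli w).real (⋃ a ∈ A, openConn o a) - t ≤ (prodBernoulli w).real (openConn o b) :=
  fun _ w hw A o b t ht hrel => agBody_of_zeroOne w hw A o b t ht hrel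

end ZeroOne

end

end Summit.CriticalPhenomena.PercolationContinuityZ3.Theorems
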